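import Summits.CriticalPhenomena.PercolationContinuityZ3.Theorems.PercNearOneGluingNoHeavyLowerTailMixCSHLemmaT
import Summits.CriticalPhenomena.PercolationContinuityZ3.Theorems.PercNearOneGluingNoHeavyLowerTailMixCSHHtwBridge
import HarnessLib

/-!
# Mixed conditioned slack hierarchy — the INDUCTION SKELETON of Theorem M1 (level zero + strong induction on the decoy list)

Support file (`--supports stmt-CriticalPhenomena-4575`), prover `prim-ineq-gen-7` (gen 9).  No definitions, no named facts, no sorries.
Memo `prim-ineq-gen-7/PROOF-Q9-MIXED-CSH.md` §3.5; blueprint §10 brick B5 (first half: mirror of prim-png-lead's `CSH.cshMargin_nonneg_of_unfold`).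

* `MixCSH.mixCshMargin_nil_nonneg` — LEVEL ZERO of the mixed hierarchy, UNCONDITIONAL: for weights `< 1`, `v ∉ {x} ∪ Y`, `o ≠ v` and every
  monotone `f`, `0 ≤ mixCshMargin w Σ x Y [] o v f` — mixed Lemma T (`MixCSH.mixCshMargin_nonneg_of_within`, prim-hp-7, brick B1) fed with
  LEMMA H-mix at the marker set `S = {x}` (`MixCSH.hpart_nonneg_hub`, brick B4).
* `MixCSH.mixCshMargin_nonneg_of_unfold` — THEOREM M1 for every decoy list from the ONE-LEVEL UNFOLDING STEP `hU` (bricks B2 + B3 + B4: the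
  world-wise mixed margin of a datum with `D ≠ []` is nonnegative as soon as every lower-level mixed margin
  `mixCshMargin w Σ d ({x} ∪ Y ∪ pre) ds' o v h` is), by strong induction on the length of the list; `hU` is stated in the verbatim vocabulary of
  `MixCSH.mixCshMargin_nonneg_of_within`.
* `MixCSH.mixCSHHolds_of_unfold` — the same in the `MixCSHHolds` vocabulary of `MixCSH.kn_question9_of_mixCSH` / `mixPreMargin_nonneg_of_mixCSH`.
[cite: VandenbergHaggstromKahn2005, §2.1 (pp. 9–13)] [cite: KozmaNitzan2024, Question 9 (§5.5 p. 36), Conj. 6 (§5.3 p. 34)]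
-/

noncomputable section

namespace Summit.CriticalPhenomena.PercolationContinuityZ3.Theorems

open MeasureTheory Set Literature.Probability.LatticeModels Literature.Probability.Percolation
open scoped Classical

namespace MixCSH

variable {V : Type*} [Fintype V]

/-- **Level zero of the mixed hierarchy, UNCONDITIONAL** (memo §3.5, `k = 0`: Lemma T-mix + Lemma H-mix at `S = {x}`): for weights `< 1`,
`v ∉ {x} ∪ Y`, `o ≠ v` and every monotone `f`,  `0 ≤ mixCshMargin w Σ x Y [] o v f`.
[cite: VandenbergHaggstromKahn2005, §2.1 (pp. 9–13), Thm. 2.1 (p. 9)] [cite: KozmaNitzan2024, Question 9 (§5.5 p. 36)] -/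
theorem mixCshMargin_nil_nonneg (w : Sym2 V → unitInterval) (hw : ∀ e, w e < 1) (Sig : Set V) (x : V) (Y : Set V) (o v : V)
    (hov : o ≠ v) (hv : v ∉ insert x Y) (f : Set (Sym2 V) → ℝ) (hf : Monotone f) :
    0 ≤ mixCshMargin w Sig x Y [] o v f := by
  have hvx : v ∉ ({x} : Finset V) := fun h => hv (Finset.mem_singleton.1 h ▸ Set.mem_insert x Y)
  have hvY : v ∉ Y := fun h => hv (Set.mem_insert_of_mem x h)
  have hY : ∀ e : Sym2 V, ¬ e.IsDiag → (∃ u ∈ e, u ∈ Y) → (w e : ℝ) < 1 :=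
    fun e _ _ => unitInterval.coe_lt_one.2 (hw e)
  refine mixCshMargin_nonneg_of_within w Sig x Y [] o v hov List.not_mem_nil hY (fun g hg hg0 => ?_) f hf
  have h := hpart_nonneg_hub w hw x Y {x} (Finset.mem_singleton_self x) Sig v hvx hvY g hg hg0
  have hset : (↑({x} : Finset V) ∪ Y : Set V) = insert x Y ∪ {d | d ∈ ([] : List V)} := by
    ext u; simp
  have hS1 : {η : BondConfig V | ∃ σ ∈ Sig, ∃ t ∈ ({x} : Finset V), (openGraph η).Reachable t σ} =
      {η : BondConfig V | ∃ z ∈ Sig, (openGraph η).Reachable x z} := by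
    ext η; simp
  have hS2 : (⋃ t ∈ ({x} : Finset V), (openConn v t : Set (BondConfig V))) = openConn x v := by
    ext η
    simp only [Finset.mem_singleton, iUnion_iUnion_eq_left]
    exact ⟨fun h' => SimpleGraph.Reachable.symm h', fun h' => SimpleGraph.Reachable.symm h'⟩
  rw [hset, hS1, hS2] at h
  have hvo : v ≠ o := Ne.symm hov
  refine h.trans_eq (setIntegral_congr_fun MeasurableSet.of_discrete fun ω _ => ?_)
  simp only [mixDecoyList, CSH.cshMarg_nil, if_true, hvo, if_false]
  ring

/-- **Theorem M1 from the one-level unfolding step** (strong induction on the number of decoys; memo §3.5).  Fix weights `< 1` and a hub set `Σ`.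
HYPOTHESIS `hU` (= mixed Lemmas U + H + R⁻, bricks B2–B4): for every datum (owner `x`, avoided set `Y`, NONEMPTY decoy list `D`, hub label `o`, observer
`v`, all named vertices distinct and `o` outside them), IF every lower-level mixed margin `mixCshMargin w Σ d ({x} ∪ Y ∪ pre) ds' o v h`
(`D = pre ++ d :: ds'`, `h` monotone `≥ 0`) is nonnegative, THEN the world-wise mixed margin of `MixCSH.mixCshMargin_nonneg_of_within` is nonnegative
for every monotone `g ≥ 0`.  CONCLUSION: `0 ≤ mixCshMargin w Σ x Y D o v f` for every datum and every monotone `f`.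
[cite: VandenbergHaggstromKahn2005, §2.1 (pp. 9–13)] [cite: KozmaNitzan2024, Question 9 (§5.5 p. 36)] -/
theorem mixCshMargin_nonneg_of_unfold (w : Sym2 V → unitInterval) (hw : ∀ e, w e < 1) (Sig : Set V)
    (hU : ∀ (x : V) (Y : Set V) (D : List V) (o v : V),
      x ∉ Y → o ∉ insert x Y → v ∉ insert x Y → o ≠ v → D ≠ [] → D.Nodup → (∀ d ∈ D, d ∉ insert x Y ∧ d ≠ o ∧ d ≠ v) →
      (∀ (pre : List V) (d : V) (ds' : List V), D = pre ++ d :: ds' →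
        ∀ h : Set (Sym2 V) → ℝ, Monotone h → (∀ C, 0 ≤ h C) →
          0 ≤ mixCshMargin w Sig d (insert x Y ∪ {e | e ∈ pre}) ds' o v h) →
      ∀ g : Set (Sym2 V) → ℝ, Monotone g → (∀ C, 0 ≤ g C) →
      0 ≤ ∫ ω in {ω : BondConfig V | ∀ y ∈ Y, ¬ (openGraph ω).Reachable x y},
        CSH.cshMarg (mixDecoyList w Sig o (insert x Y) D) (mixObsConst w Sig v (insert x Y ∪ {d | d ∈ D})) o v
          (fun u => if u = o then
              (if (∀ z ∈ Sig, ∀ y ∈ Y, ¬ (openGraph ω).Reachable y z) then (1 : ℝ) else 0) *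
                ((∫ η in {η : BondConfig V | ∃ z ∈ Sig, (openGraph η).Reachable x z}, g (openEdgeCluster η x)
                    ∂(prodBernoulli fun e => if (∃ z ∈ e, ∃ y ∈ Y, (openGraph ω).Reachable y z)
                      then (0 : unitInterval) else w e)) -
                  (∫ η, g (openEdgeCluster η x)
                    ∂(prodBernoulli fun e => if (∃ z ∈ e, ∃ y ∈ Y, (openGraph ω).Reachable y z)
                      then (0 : unitInterval) else w e)) *
                  (prodBernoulli fun e => if (∃ z ∈ e, ∃ y ∈ Y, (openGraph ω).Reachable y z)
                      then (0 : unitInterval) else w e).real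
                    {η : BondConfig V | ∃ z ∈ Sig, (openGraph η).Reachable x z})
            else
              (∫ η in (openConn x u : Set (BondConfig V)), g (openEdgeCluster η x)
                  ∂(prodBernoulli fun e => if (∃ z ∈ e, ∃ y ∈ Y, (openGraph ω).Reachable y z)
                    then (0 : unitInterval) else w e)) -
                (∫ η, g (openEdgeCluster η x)
                  ∂(prodBernoulli fun e => if (∃ z ∈ e, ∃ y ∈ Y, (openGraph ω).Reachable y z)
                    then (0 : unitInterval) else w e)) *
                (prodBernoulli fun e => if (∃ z ∈ e, ∃ y ∈ Y, (openGraph ω).Reachable y z)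
                    then (0 : unitInterval) else w e).real (openConn x u : Set (BondConfig V)))
        ∂(prodBernoulli w)) :
    ∀ (D : List V) (x : V) (Y : Set V) (o v : V),
      x ∉ Y → o ∉ insert x Y → v ∉ insert x Y → o ≠ v → D.Nodup → (∀ d ∈ D, d ∉ insert x Y ∧ d ≠ o ∧ d ≠ v) →
      ∀ f : Set (Sym2 V) → ℝ, Monotone f → 0 ≤ mixCshMargin w Sig x Y D o v f := by
  -- strong induction on the length of the decoy list
  suffices hk : ∀ (k : ℕ) (D : List V), D.length ≤ k → ∀ (x : V) (Y : Set V) (o v : V),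
      x ∉ Y → o ∉ insert x Y → v ∉ insert x Y → o ≠ v → D.Nodup → (∀ d ∈ D, d ∉ insert x Y ∧ d ≠ o ∧ d ≠ v) →
      ∀ f : Set (Sym2 V) → ℝ, Monotone f → 0 ≤ mixCshMargin w Sig x Y D o v f from
    fun D => hk D.length D le_rfl
  intro k
  induction k with
  | zero =>
    intro D hD x Y o v _ _ hv hov _ _ f hf
    have hD0 : D = [] := List.eq_nil_of_length_eq_zero (Nat.le_zero.1 hD)
    subst hD0
    exact mixCshMargin_nil_nonneg w hw Sig x Y o v hov hv f hf
  | succ k ih =>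
    intro D hD x Y o v hxY ho hv hov hnd hdis f hf
    by_cases hnil : D = []
    · subst hnil
      exact mixCshMargin_nil_nonneg w hw Sig x Y o v hov hv f hf
    -- Lemma T-mix: reduce to the world-wise margin
    have hY : ∀ e : Sym2 V, ¬ e.IsDiag → (∃ u ∈ e, u ∈ Y) → (w e : ℝ) < 1 :=
      fun e _ _ => unitInterval.coe_lt_one.2 (hw e)
    have hoD : o ∉ D := fun h => (hdis o h).2.1 rfl
    refine mixCshMargin_nonneg_of_within w Sig x Y D o v hov hoD hY (fun g hg hg0 => ?_) f hf
    refine hU x Y D o v hxY ho hv hov hnil hnd hdis (fun pre d ds' hsplit h hh hh0 => ?_) g hg hg0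
    -- the lower level `(d | {x} ∪ Y ∪ pre ; ds')` has fewer decoys: induction hypothesis
    have hlen : ds'.length ≤ k := by
      have : D.length = pre.length + (ds'.length + 1) := by rw [hsplit, List.length_append, List.length_cons]
      omega
    have hdD : d ∈ D := by rw [hsplit]; exact List.mem_append_right pre List.mem_cons_self
    have hpreD : ∀ e ∈ pre, e ∈ D := fun e he => by rw [hsplit]; exact List.mem_append_left _ he
    have hds'D : ∀ e ∈ ds', e ∈ D := fun e he => by rw [hsplit]; exact List.mem_append_right pre (List.mem_cons_of_mem d he)
    have hnd' : (pre ++ d :: ds').Nodup := hsplit ▸ hnd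
    have hnd_ds' : ds'.Nodup := (List.nodup_cons.1 (List.nodup_append.1 hnd').2.1).2
    have hd_notin_ds' : d ∉ ds' := (List.nodup_cons.1 (List.nodup_append.1 hnd').2.1).1
    have hd_notin_pre : d ∉ pre := fun hdp =>
      (List.nodup_append.1 hnd').2.2 d hdp d List.mem_cons_self rfl
    have hds'_notin_pre : ∀ e ∈ ds', e ∉ pre := fun e he hep =>
      (List.nodup_append.1 hnd').2.2 e hep e (List.mem_cons_of_mem d he) rfl
    set Y' : Set V := insert x Y ∪ {e | e ∈ pre} with hY'
    have hdY' : d ∉ Y' := by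
      rintro (h1 | h2)
      · exact (hdis d hdD).1 h1
      · exact hd_notin_pre h2
    have hoY' : o ∉ insert d Y' := by
      rintro (h0 | h1 | h2)
      · exact (hdis d hdD).2.1 h0.symm
      · exact ho h1
      · exact (hdis o (hpreD o h2)).2.1 rfl
    have hvY' : v ∉ insert d Y' := by
      rintro (h0 | h1 | h2)
      · exact (hdis d hdD).2.2 h0.symm
      · exact hv h1
      · exact (hdis v (hpreD v h2)).2.2 rfl
    have hdis' : ∀ e ∈ ds', e ∉ insert d Y' ∧ e ≠ o ∧ e ≠ v := by
      intro e he
      refine ⟨?_, (hdis e (hds'D e he)).2.1, (hdis e (hds'D e he)).2.2⟩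
      rintro (h0 | h1 | h2)
      · exact hd_notin_ds' (h0 ▸ he)
      · exact (hdis e (hds'D e he)).1 h1
      · exact hds'_notin_pre e he h2
    exact ih ds' hlen d Y' o v hdY' hoY' hvY' hov hnd_ds' hdis' h hh

/-- **`MixCSHHolds` for every datum from the one-level unfolding step** (wrapper of `mixCshMargin_nonneg_of_unfold` in the `MixCSHHolds` vocabulary
of `MixCSH.mixPreMargin_nonneg_of_mixCSH` / `MixCSH.kn_question9_of_mixCSH`). [cite: KozmaNitzan2024, Question 9 (§5.5 p. 36)] -/
theorem mixCSHHolds_of_unfold (w : Sym2 V → unitInterval) (hw : ∀ e, w e < 1) (Sig : Set V)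
    (hU : ∀ (x : V) (Y : Set V) (D : List V) (o v : V),
      x ∉ Y → o ∉ insert x Y → v ∉ insert x Y → o ≠ v → D ≠ [] → D.Nodup → (∀ d ∈ D, d ∉ insert x Y ∧ d ≠ o ∧ d ≠ v) →
      (∀ (pre : List V) (d : V) (ds' : List V), D = pre ++ d :: ds' →
        ∀ h : Set (Sym2 V) → ℝ, Monotone h → (∀ C, 0 ≤ h C) →
          0 ≤ mixCshMargin w Sig d (insert x Y ∪ {e | e ∈ pre}) ds' o v h) →
      ∀ g : Set (Sym2 V) → ℝ, Monotone g → (∀ C, 0 ≤ g C) →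
      0 ≤ ∫ ω in {ω : BondConfig V | ∀ y ∈ Y, ¬ (openGraph ω).Reachable x y},
        CSH.cshMarg (mixDecoyList w Sig o (insert x Y) D) (mixObsConst w Sig v (insert x Y ∪ {d | d ∈ D})) o v
          (fun u => if u = o then
              (if (∀ z ∈ Sig, ∀ y ∈ Y, ¬ (openGraph ω).Reachable y z) then (1 : ℝ) else 0) *
                ((∫ η in {η : BondConfig V | ∃ z ∈ Sig, (openGraph η).Reachable x z}, g (openEdgeCluster η x)
                    ∂(prodBernoulli fun e => if (∃ z ∈ e, ∃ y ∈ Y, (openGraph ω).Reachable y z)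
                      then (0 : unitInterval) else w e)) -
                  (∫ η, g (openEdgeCluster η x)
                    ∂(prodBernoulli fun e => if (∃ z ∈ e, ∃ y ∈ Y, (openGraph ω).Reachable y z)
                      then (0 : unitInterval) else w e)) *
                  (prodBernoulli fun e => if (∃ z ∈ e, ∃ y ∈ Y, (openGraph ω).Reachable y z)
                      then (0 : unitInterval) else w e).real
                    {η : BondConfig V | ∃ z ∈ Sig, (openGraph η).Reachable x z})
            else
              (∫ η in (openConn x u : Set (BondConfig V)), g (openEdgeCluster η x)
                  ∂(prodBernoulli fun e => if (∃ z ∈ e, ∃ y ∈ Y, (openGraph ω).Reachable y z)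
                    then (0 : unitInterval) else w e)) -
                (∫ η, g (openEdgeCluster η x)
                  ∂(prodBernoulli fun e => if (∃ z ∈ e, ∃ y ∈ Y, (openGraph ω).Reachable y z)
                    then (0 : unitInterval) else w e)) *
                (prodBernoulli fun e => if (∃ z ∈ e, ∃ y ∈ Y, (openGraph ω).Reachable y z)
                    then (0 : unitInterval) else w e).real (openConn x u : Set (BondConfig V)))
        ∂(prodBernoulli w))
    (x : V) (Y : Set V) (D : List V) (o v : V)
    (hxY : x ∉ Y) (ho : o ∉ insert x Y) (hv : v ∉ insert x Y) (hov : o ≠ v) (hnd : D.Nodup)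
    (hdis : ∀ d ∈ D, d ∉ insert x Y ∧ d ≠ o ∧ d ≠ v) :
    MixCSHHolds w Sig x Y D o v :=
  fun f hf => mixCshMargin_nonneg_of_unfold w hw Sig hU D x Y o v hxY ho hv hov hnd hdis f hf

end MixCSH

end Summit.CriticalPhenomena.PercolationContinuityZ3.Theorems
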